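import Summits.CriticalPhenomena.PercolationContinuityZ3.Theorems.PercNearOneGluingNoHeavyLowerTailSahiCombTriWSandwich

/-!
# The J-SWITCH criterion: Formula A with some diagonal units replaced by antipodal JOIN literals, as a sandwich certificate

Support file of the one-cut programme (crux `NoHeavyLowerTail`, stmt-CriticalPhenomena-4575; TRI lane of cell `prim-masterthm`; seat prim-lf-1 gen 40,
memo `FROM-prim-lf-1-gen40-CYLINDER-AND-JSWITCH.md` §0, §2).  Continuation of `…SahiCombTriWSandwich` (P5 gen 24) and `…SahiCombTriWSaturated` (Formula A).

Exact LP censuses of this generation (kit j173372 n = 4, j173893 n = 5) show that most non-saturated up-sets `P` (28/29 classes of `2^4`, 109 of the 122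
non-saturated classes of `2^5`, the `K₂₂` family included, `c = 1`, integral) are certified by FORMULA A WITH J-SWITCHES: for a set `T ⊆ E = P \ refl P` of
diagonal points, replace the diagonal unit `[t∈A][t∈B]` by the product of ANTIPODAL JOIN literals `J_t(A)·J_t(B)`, `J_t(A) = [t ∈ A ∨ tᶜ ∈ A]`; keep the
antidiagonal units on `Q = P ∩ refl P` and the diagonal units on `E \ T`.  The value of this weight on a pair of families is

  `k_T(A,B) = #(Q ∩ A ∩ refl B) + #((E \ T) ∩ A ∩ B) + #(T ∩ (A ∪ refl A) ∩ (B ∪ refl B))`     (`FiveUpSet.jsVal`).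

This file makes the criterion available once and for all:
* `FiveUpSet.litValI`, **`FiveUpSet.triW_nonneg_of_sandwichFamily`** — the sandwich principle of `…TriWSandwich` for literal families indexed by an ARBITRARY
  finite type (transport to `Fin k` along `Fintype.equivFin`), so that certificates indexed by the points of the cube can be used directly;
* `FiveUpSet.jsLam / jsV / jsB` — the J-switch literal family (indexed by the points `t : Finset γ`), monotone (`monoLit_jsV`, `monoLit_jsB`), with
  `litValI = jsVal` (`litValI_js`);
* **`FiveUpSet.triW_nonneg_of_jswitch`**: if `P` is an up-set, `T ⊆ P \ refl P`, and `L_P ≤ k_T ≤ U_P` on all pairs of up-sets, then `0 ≤ triW P F G` for every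
  index cube and all monotone families of up-sets.  (In gap form: `ζ − Kl_W ≤ g_T ≤ S_P`, memo §0; `T = ∅` is the saturated stratum's Formula A.)
HONEST LABEL: complete proofs, std axioms; a CRITERION (the two inequalities remain hypotheses) — which `(P, T)` satisfy them beyond `n ≤ 5` is OPEN. [this work]
-/

namespace Summit.CriticalPhenomena.PercolationContinuityZ3.Theorems

namespace FiveUpSet

open Finset

variable {β γ : Type} [DecidableEq β] [Fintype β] [DecidableEq γ] [Fintype γ]

/-! ### The sandwich principle for literal families indexed by any finite type -/

/-- `k(A,B) = Σ_i λ_i [V_i A][B_i B]` for a family indexed by a finite type `ι`. [this work] -/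
def litValI {ι : Type} [Fintype ι] (lam : ι → ℕ) (V B : ι → (Finset (Finset γ) → Bool)) (A Bs : Finset (Finset γ)) : ℤ :=
  ∑ i : ι, (lam i : ℤ) * bInd (V i) A * bInd (B i) Bs

omit [DecidableEq β] [Fintype β] [DecidableEq γ] [Fintype γ] in
/-- Re-indexing along `Fintype.equivFin`: the `ι`-indexed form is a `Fin k`-indexed `litVal`. [this work] -/
theorem litValI_eq_litVal {ι : Type} [Fintype ι] (lam : ι → ℕ) (V B : ι → (Finset (Finset γ) → Bool)) (A Bs : Finset (Finset γ)) :
    litValI lam V B A Bs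
      = litVal (fun j => lam ((Fintype.equivFin ι).symm j)) (fun j => V ((Fintype.equivFin ι).symm j))
          (fun j => B ((Fintype.equivFin ι).symm j)) A Bs := by
  unfold litValI litVal
  exact (Fintype.sum_equiv (Fintype.equivFin ι).symm _ _ (fun _ => rfl)).symm

/-- **The sandwich principle, any finite index type.**  If `c > 0`, the literals are monotone, and `c·L_P ≤ k ≤ c·U_P` on all pairs of up-sets for
`k = Σ_i λ_i V_i ⊗ B_i`, then `0 ≤ triW P F G` for every index cube and all monotone families of up-sets. [this work] -/
theorem triW_nonneg_of_sandwichFamily {ι : Type} [Fintype ι] {P : Finset (Finset γ)} {c : ℕ} {lam : ι → ℕ}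
    {V B : ι → (Finset (Finset γ) → Bool)} (hc : 0 < c) (hV : ∀ i, MonoLit (V i)) (hB : ∀ i, MonoLit (B i))
    (hcert : ∀ A Bs : Finset (Finset γ), IsUpperSet (A : Set (Finset γ)) → IsUpperSet (Bs : Set (Finset γ)) →
      (c : ℤ) * lForm P A Bs ≤ litValI lam V B A Bs ∧ litValI lam V B A Bs ≤ (c : ℤ) * uForm P A Bs)
    (F G : Finset β → Finset (Finset γ))
    (hF : ∀ x, IsUpperSet (F x : Set (Finset γ))) (hG : ∀ x, IsUpperSet (G x : Set (Finset γ)))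
    (hFm : Monotone F) (hGm : Monotone G) :
    0 ≤ triW P F G := by
  refine triW_nonneg_of_sandwichCert (lam := fun j => lam ((Fintype.equivFin ι).symm j))
    (V := fun j => V ((Fintype.equivFin ι).symm j)) (B := fun j => B ((Fintype.equivFin ι).symm j))
    hc (fun j => hV _) (fun j => hB _) ?_ F G hF hG hFm hGm
  intro A Bs hA hBs
  rw [← litValI_eq_litVal]
  exact hcert A Bs hA hBs

/-! ### The J-switch literal family -/

/-- Weights: one unit at every point of `P`. [this work] -/
def jsLam (P : Finset (Finset γ)) (t : Finset γ) : ℕ := if t ∈ P then 1 else 0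

/-- Left literal at `t`: the join `[t ∈ A ∨ tᶜ ∈ A]` on `T`, the point literal `[t ∈ A]` elsewhere. [this work] -/
def jsV (T : Finset (Finset γ)) (t : Finset γ) (A : Finset (Finset γ)) : Bool :=
  if t ∈ T then (decide (t ∈ A) || decide (tᶜ ∈ A)) else decide (t ∈ A)

/-- Right literal at `t`: the join on `T`, the antipodal point literal `[tᶜ ∈ B]` on `Q = P ∩ refl P`, the point literal `[t ∈ B]` elsewhere. [this work] -/
def jsB (P T : Finset (Finset γ)) (t : Finset γ) (Bs : Finset (Finset γ)) : Bool :=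
  if t ∈ T then (decide (t ∈ Bs) || decide (tᶜ ∈ Bs)) else if tᶜ ∈ P then decide (tᶜ ∈ Bs) else decide (t ∈ Bs)

omit [DecidableEq β] [Fintype β] in
/-- The left literals are monotone. [this work] -/
theorem monoLit_jsV (T : Finset (Finset γ)) (t : Finset γ) : MonoLit (jsV T t) := by
  intro A A' hAA h
  unfold jsV at h ⊢
  by_cases ht : t ∈ T
  · rw [if_pos ht] at h ⊢
    rw [Bool.or_eq_true, decide_eq_true_eq, decide_eq_true_eq] at h ⊢
    rcases h with h | h
    · exact Or.inl (hAA h)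
    · exact Or.inr (hAA h)
  · rw [if_neg ht] at h ⊢
    rw [decide_eq_true_eq] at h ⊢
    exact hAA h

omit [DecidableEq β] [Fintype β] in
/-- The right literals are monotone. [this work] -/
theorem monoLit_jsB (P T : Finset (Finset γ)) (t : Finset γ) : MonoLit (jsB P T t) := by
  intro A A' hAA h
  unfold jsB at h ⊢
  by_cases ht : t ∈ T
  · rw [if_pos ht] at h ⊢
    rw [Bool.or_eq_true, decide_eq_true_eq, decide_eq_true_eq] at h ⊢
    rcases h with h | h
    · exact Or.inl (hAA h)
    · exact Or.inr (hAA h)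
  · rw [if_neg ht] at h ⊢
    by_cases hq : tᶜ ∈ P
    · rw [if_pos hq] at h ⊢
      rw [decide_eq_true_eq] at h ⊢
      exact hAA h
    · rw [if_neg hq] at h ⊢
      rw [decide_eq_true_eq] at h ⊢
      exact hAA h

/-- **The value of the J-switch weight**: `k_T(A,B) = #(Q ∩ A ∩ refl B) + #((E \ T) ∩ A ∩ B) + #(T ∩ (A ∪ refl A) ∩ (B ∪ refl B))`
with `Q = P ∩ refl P`, `E = P \ refl P`. [this work] -/
def jsVal (P T A B : Finset (Finset γ)) : ℤ :=
  ((P ∩ refl P ∩ A ∩ refl B).card : ℤ) + (((P \ refl P) \ T) ∩ A ∩ B).card + (T ∩ (A ∪ refl A) ∩ (B ∪ refl B)).card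

omit [DecidableEq β] [Fintype β] in
/-- The summand of the J-switch form at a point `t`, for `T ⊆ P \ refl P`. [this work] -/
theorem js_summand {P T : Finset (Finset γ)} (hT : T ⊆ P \ refl P) (A Bs : Finset (Finset γ)) (t : Finset γ) :
    (jsLam P t : ℤ) * bInd (jsV T t) A * bInd (jsB P T t) Bs
      = (if t ∈ P ∩ refl P ∩ A ∩ refl Bs then 1 else 0) + (if t ∈ ((P \ refl P) \ T) ∩ A ∩ Bs then 1 else 0)
        + (if t ∈ T ∩ (A ∪ refl A) ∩ (Bs ∪ refl Bs) then 1 else 0) := by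
  unfold jsLam jsV jsB bInd
  beta_reduce
  by_cases hP : t ∈ P
  · by_cases ht : t ∈ T
    · have hE := hT ht
      rw [mem_sdiff, mem_refl] at hE
      have h1 : t ∉ P ∩ refl P ∩ A ∩ refl Bs := fun h => hE.2 (mem_refl.1 (mem_inter.1 (mem_inter.1 (mem_inter.1 h).1).1).2)
      have h2 : t ∉ ((P \ refl P) \ T) ∩ A ∩ Bs := fun h => (mem_sdiff.1 (mem_inter.1 (mem_inter.1 h).1).1).2 ht
      rw [if_neg h1, if_neg h2, if_pos hP, if_pos ht, if_pos ht]
      simp only [mem_inter, mem_union, mem_refl, ht, true_and, Bool.or_eq_true, decide_eq_true_eq]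
      by_cases a1 : t ∈ A <;> by_cases a2 : tᶜ ∈ A <;> by_cases b1 : t ∈ Bs <;> by_cases b2 : tᶜ ∈ Bs <;> simp [a1, a2, b1, b2]
    · by_cases hq : tᶜ ∈ P
      · have h2 : t ∉ ((P \ refl P) \ T) ∩ A ∩ Bs := fun h => (mem_sdiff.1 (mem_sdiff.1 (mem_inter.1 (mem_inter.1 h).1).1).1).2 (mem_refl.2 hq)
        have h3 : t ∉ T ∩ (A ∪ refl A) ∩ (Bs ∪ refl Bs) := fun h => ht (mem_inter.1 (mem_inter.1 h).1).1
        rw [if_neg h2, if_neg h3, if_pos hP, if_neg ht, if_neg ht, if_pos hq]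
        simp only [mem_inter, mem_refl, hP, hq, true_and, decide_eq_true_eq]
        by_cases a1 : t ∈ A <;> by_cases b2 : tᶜ ∈ Bs <;> simp [a1, b2]
      · have h1 : t ∉ P ∩ refl P ∩ A ∩ refl Bs := fun h => hq (mem_refl.1 (mem_inter.1 (mem_inter.1 (mem_inter.1 h).1).1).2)
        have h3 : t ∉ T ∩ (A ∪ refl A) ∩ (Bs ∪ refl Bs) := fun h => ht (mem_inter.1 (mem_inter.1 h).1).1
        rw [if_neg h1, if_neg h3, if_pos hP, if_neg ht, if_neg ht, if_neg hq]
        have hmem : t ∈ (P \ refl P) \ T := mem_sdiff.2 ⟨mem_sdiff.2 ⟨hP, fun h => hq (mem_refl.1 h)⟩, ht⟩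
        simp only [mem_inter, hmem, true_and, decide_eq_true_eq]
        by_cases a1 : t ∈ A <;> by_cases b1 : t ∈ Bs <;> simp [a1, b1]
  · have ht : t ∉ T := fun h => hP (mem_sdiff.1 (hT h)).1
    have h1 : t ∉ P ∩ refl P ∩ A ∩ refl Bs := fun h => hP (mem_inter.1 (mem_inter.1 (mem_inter.1 h).1).1).1
    have h2 : t ∉ ((P \ refl P) \ T) ∩ A ∩ Bs := fun h => hP (mem_sdiff.1 (mem_sdiff.1 (mem_inter.1 (mem_inter.1 h).1).1).1).1
    have h3 : t ∉ T ∩ (A ∪ refl A) ∩ (Bs ∪ refl Bs) := fun h => ht (mem_inter.1 (mem_inter.1 h).1).1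
    rw [if_neg h1, if_neg h2, if_neg h3, if_neg hP]
    simp

omit [DecidableEq β] [Fintype β] in
/-- **`litValI (jsLam P) (jsV T) (jsB P T) A B = k_T(A,B)`.** [this work] -/
theorem litValI_js {P T : Finset (Finset γ)} (hT : T ⊆ P \ refl P) (A Bs : Finset (Finset γ)) :
    litValI (jsLam P) (jsV T) (jsB P T) A Bs = jsVal P T A Bs := by
  unfold litValI jsVal
  rw [Finset.sum_congr rfl (fun t _ => js_summand hT A Bs t), sum_add_distrib, sum_add_distrib, sum_boole, sum_boole, sum_boole]
  simp only [filter_univ_mem]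

/-- **THE J-SWITCH CRITERION.**  `P` an up-set, `T ⊆ P \ refl P`; if `L_P(A,B) ≤ k_T(A,B) ≤ U_P(A,B)` for all up-sets `A, B`, then `0 ≤ triW P F G` for every
index cube `Finset β` and all monotone families `F, G` of up-sets. [this work] -/
theorem triW_nonneg_of_jswitch {P T : Finset (Finset γ)} (hT : T ⊆ P \ refl P)
    (hlo : ∀ A B : Finset (Finset γ), IsUpperSet (A : Set (Finset γ)) → IsUpperSet (B : Set (Finset γ)) → lForm P A B ≤ jsVal P T A B)
    (hhi : ∀ A B : Finset (Finset γ), IsUpperSet (A : Set (Finset γ)) → IsUpperSet (B : Set (Finset γ)) → jsVal P T A B ≤ uForm P A B)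
    (F G : Finset β → Finset (Finset γ))
    (hF : ∀ x, IsUpperSet (F x : Set (Finset γ))) (hG : ∀ x, IsUpperSet (G x : Set (Finset γ)))
    (hFm : Monotone F) (hGm : Monotone G) :
    0 ≤ triW P F G := by
  refine triW_nonneg_of_sandwichFamily (ι := Finset γ) (c := 1) (lam := jsLam P) (V := jsV T) (B := jsB P T) Nat.one_pos
    (fun t => monoLit_jsV T t) (fun t => monoLit_jsB P T t) ?_ F G hF hG hFm hGm
  intro A Bs hA hBs
  rw [litValI_js hT, Nat.cast_one, one_mul, one_mul]
  exact ⟨hlo A Bs hA hBs, hhi A Bs hA hBs⟩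

end FiveUpSet

end Summit.CriticalPhenomena.PercolationContinuityZ3.Theorems
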